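/-
Copyright: the b2b-balaban T⁴-continuum CRUX team, row NE7b OWNER lineage `t4-ne7b-p1` (gen 117). Project licence.
-/
import Mathlib.Analysis.Calculus.Deriv.MeanValue
import Summits.QuantumFields.BalabanUV.T4Continuum.Spine.NE7b.SupTorusDirichletFormCoercive
import Summits.QuantumFields.BalabanUV.T4Continuum.Spine.NE7b.SupTorusEffectiveActionInstance

/-!
# THE TORUS ACTION IS STRONGLY CONVEX AND THE BACKGROUND MINIMISES IT ON ITS FIBRE: with the torus Dirichlet floor `min(2,a)` of
# `Δ^η + aQ′*Q′` ((89)) and a sitewise curvature `u′ ≥ −λ`, the action `S φ = ½Σ_x φ·(At φ) + Σ_x v(φ x)` on the fine torus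
# satisfies the FIRST-ORDER LETTER `S φ + DS(φ)(ψ − φ) + ½(min(2,a) − λ)·Σ_x (ψ − φ)² ≤ S ψ` for ALL `φ, ψ`; hence a field solving
# the sitewise equation (SBTL's closed-ball letter) is THE STRICT MINIMISER of `S` on its block-average fibre with quadratic gain,
# and two solutions with the same block means coincide — criticality IS minimality, every mesh, period and dimension
# (row NE7b, node U5c; (89) + TEA + INST BY NAME; [folklore])

Cell `pub-balaban`, sub-cell `t4`, spine estimate NE7b (`T4WeightBudget.RelWeightBound`; the cell's OWN estimate — NOT PRINTED in
[Bałaban 1983–89], NOT PROVED).  Crux-route work under `Spine/NE7b/` by the row OWNER (`t4-ne7b-p1` gen 117) under FREEZE (0)'s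
crux-prover clause, on leaf-03 g156's located items («NOT typed: … minimality ∕ existence of critical points», [NE7bLEAF03-G156-INBOX]);
NOTHING of Bałaban's is named as a Lean object, valued or asserted; no `T4Continuum/Support` leaf typed; no `def`, no notation; zero
`sorry`.  Imports (BY NAME): the OWNER's (89) `…SupTorusDirichletFormCoercive` (`torus_form_coercive`), leaf-03's INST
`…SupTorusEffectiveActionInstance` (`fderiv_action_torus_eq_zero`; through it TEA `hasFDerivAt_action` ∕ `fderiv_action_apply` and
TDF `torus_operator_form_symm`), `Mathlib.Analysis.Calculus.Deriv.MeanValue` (`exists_hasDerivAt_eq_slope`, `monotoneOn_of_deriv_nonneg`).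

WHY (located).  The sup road defines the background `σ(w)` as the CRITICAL point of the action on the fibre `{Q′φ = w}` delivered by
the implicit-function chart (ASE ∕ (58) ∕ (60)); print's background is the MINIMISER of the action under the averaging constraint
([B11] p. 19 «H_k B is a minimum of ½⟨∂A, ∂A⟩ on the hyperplane …»; King CMP 102 (2.9)).  On the torus the two agree, quantitatively
and for a reason that uses no smallness of the field: `DS` is STRONGLY MONOTONE — `⟨DS(ψ) − DS(φ), ψ − φ⟩ = ⟨h, At h⟩ + Σ_x (u(ψ x) −
u(φ x))(ψ x − φ x) ≥ (min(2,a) − λ)·Σ h²` by (89) and the one-variable mean-value letter `(u b − u a)(b − a) ≥ −λ(b − a)²` — and a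
function with a strongly monotone gradient obeys the first-order letter (integrate along the segment: the gap function
`t ↦ S(φ + th) − S φ − t·DS(φ)h − ½(γ − λ)t²Σh²` has nonnegative derivative on `t ≥ 0`).  With `DS(φ)` killing the torus fibre at a
solution of the sitewise equation (INST `fderiv_action_torus_eq_zero`) the letter at `φ` toward any `ψ` of the same fibre loses its
linear term: `S φ + ½(γ − λ)Σ(ψ − φ)² ≤ S ψ`.

WHAT IS PROVED ([folklore]):
* §1 (one variable) `mul_sub_mul_sub_ge` (`u′ ≥ −λ` everywhere ⟹ `−λ(b − a)² ≤ (u b − u a)(b − a)`, mean value theorem).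
* §2 (TEA's level: finite carrier `ι`, ANY symmetric `At` with a form floor `γ`, `v′ = u`, `u′ ≥ −λ`) **`gradient_strongMonotone`**
  (`(γ − λ)·Σ(ψ − φ)² ≤ Σ_x ((At ψ + u∘ψ) − (At φ + u∘φ)) x·(ψ − φ) x`), `hasDerivAt_action_line` (the action along a segment),
  THE FIRST-ORDER LETTER **`action_firstOrder_lower`** (`S φ + DS(φ)(ψ − φ) + ½(γ − λ)Σ(ψ − φ)² ≤ S ψ`, all `φ ψ`),
  **`action_fibre_lower_of_critical`** (`DS(φ)` kills `ker Qt`, `Qt ψ = Qt φ` ⟹ `S φ + ½(γ − λ)Σ(ψ − φ)² ≤ S ψ`),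
  **`isMinOn_fibre_of_critical`** (`λ ≤ γ` ⟹ `φ` minimises `S` on its fibre), **`eq_of_critical_of_critical`** (`λ < γ`: two fibre-critical
  fields with the same `Qt` coincide).
* §3 (the `Beta.Site` carriers, displayed actions; `At = Rf∘Aop∘Ef`, `Qt = Rc∘Dop∘Ef`, `γ = min(2,a)` by (89), `|u′| ≤ λ`)
  **`torus_action_firstOrder_lower`**, and THE END **`torus_background_minimises`**: a torus field `φt` solving SBTL's sitewise equation
  satisfies `S φt + ½(min(2,a) − λ)·Σ_x (ψ − φt)² ≤ S ψ` for every `ψ` with the same torus block means; **`torus_background_isMinOn`**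
  (`λ ≤ min(2,a)`); **`torus_background_unique`** (`λ < min(2,a)`: the sitewise equation has at most one solution per fibre — SBTL's
  torus-uniqueness clause re-proved WITHOUT the chart radius, on the whole carrier).
* §4 toy.

HONEST (what this is NOT).  Finite-dimensional calculus + (89); the modulus `min(2,a) − λ` is OURS, useful only when `λ < min(2,a)`
(SBTL's `2λ ≤ c < N⁻¹` does not imply it); GLOBAL curvature letter `u′ ≥ −λ` on `ℝ` (the windowed `φ⁴` letters of (86) are not
covered); no EXISTENCE of the minimiser on fibres outside SBTL's ball is claimed (coercivity of `S` would give it; not typed); no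
statement about the measure or the fluctuation integral; cubic periods; scalar skeleton, hard constraint, not the covariant operators
((A3), NC-NE7b-α UNRULED); nothing of Bałaban's.  BY-NAME EFFECT ON THE WALL: NONE.  NE7b NOT PRINTED ∕ NOT PROVED; spine PROVED 0∕9;
rung (B)+1 on a FINITE torus — NOT infinite volume, NOT the mass gap, NOT Clay.  HONEST DEPENDENCY: continuum YM on T⁴ ⇐ BetaPertH ∧
nine spine estimates (0∕9 proved); BetaPertH ⇐ (D1) ∧ (D4) ∧ CAP+tail; G-an2-4 gates asym, D1 and NE2∕3∕4.
-/

set_option autoImplicit false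

noncomputable section

namespace Summit.QuantumFields.BalabanUV.T4Continuum.NE7b.SupTorusActionConvex

open Set Function
open scoped ENNReal Topology
open Literature.MathematicalPhysics.QuantumFieldTheory.Balaban1983to89
open B6QGQLower276 (X blk B side AX)
open B5Hk103ScalarZd (nbhd)
open Beta (Site siteOf windowMap)
open SupTorusDirichletForm (torus_operator_form_symm)
open SupTorusDirichletFormCoercive (torus_form_coercive)
open SupTorusEffectiveAction (exists_clm_pair hasFDerivAt_action fderiv_action_apply)
open SupTorusEffectiveActionInstance (fderiv_action_torus_eq_zero)

variable {d : ℕ}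

/-! ## §1. One variable: a derivative floor is a secant floor -/

/-- **`u′ ≥ −λ` EVERYWHERE ⟹ `−λ(b − a)² ≤ (u b − u a)(b − a)`** (`u + λ·id` is monotone). [folklore] -/
theorem mul_sub_mul_sub_ge {u u' : ℝ → ℝ} (hu : ∀ t, HasDerivAt u (u' t) t) {lam : ℝ} (hu' : ∀ t, -lam ≤ u' t) (a b : ℝ) :
    -lam * (b - a) ^ 2 ≤ (u b - u a) * (b - a) := by
  -- the mean value theorem on `[a, b]` (or `[b, a]`)
  have key : ∀ a b : ℝ, a < b → -lam * (b - a) ≤ u b - u a := by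
    intro a b hab
    obtain ⟨c, -, hc⟩ := exists_hasDerivAt_eq_slope u u' hab
      (fun t _ => (hu t).continuousAt.continuousWithinAt) (fun t _ => hu t)
    have h := hu' c
    rw [hc, le_div_iff₀ (sub_pos.2 hab)] at h
    linarith
  rcases lt_trichotomy a b with hab | hab | hab
  · have h := key a b hab
    nlinarith [h, hab.le]
  · subst hab; simp
  · have h := key b a hab
    nlinarith [h, hab.le]

/-! ## §2. TEA's level: strong monotonicity of the gradient and the first-order letter -/

section Generic

variable {ι κ : Type*} [Fintype ι]

/-- **THE GRADIENT OF THE ACTION IS STRONGLY MONOTONE**: with a form floor `γ·Σ h² ≤ ⟨h, At h⟩` and `u′ ≥ −λ`,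
`(γ − λ)·Σ_x (ψ − φ)² ≤ Σ_x ((At ψ) x + u(ψ x) − ((At φ) x + u(φ x)))·(ψ x − φ x)`. [folklore] -/
theorem gradient_strongMonotone (At : (ι → ℝ) →L[ℝ] (ι → ℝ)) {γ : ℝ}
    (hγ : ∀ h : ι → ℝ, γ * ∑ x, h x ^ 2 ≤ ∑ x, h x * At h x) {u u' : ℝ → ℝ} (hu : ∀ t, HasDerivAt u (u' t) t) {lam : ℝ}
    (hu' : ∀ t, -lam ≤ u' t) (φ ψ : ι → ℝ) :
    (γ - lam) * ∑ x, (ψ x - φ x) ^ 2 ≤ ∑ x, (At ψ x + u (ψ x) - (At φ x + u (φ x))) * (ψ x - φ x) := by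
  have hlin : ∀ x, At ψ x - At φ x = At (ψ - φ) x := fun x => by rw [map_sub]; rfl
  have hsplit : ∑ x, (At ψ x + u (ψ x) - (At φ x + u (φ x))) * (ψ x - φ x)
      = ∑ x, (ψ - φ) x * At (ψ - φ) x + ∑ x, (u (ψ x) - u (φ x)) * (ψ x - φ x) := by
    rw [← Finset.sum_add_distrib]
    refine Finset.sum_congr rfl fun x _ => ?_
    rw [← hlin x, Pi.sub_apply]
    ring
  have h1 := hγ (ψ - φ)
  simp only [Pi.sub_apply] at h1
  have h2 : -lam * ∑ x, (ψ x - φ x) ^ 2 ≤ ∑ x, (u (ψ x) - u (φ x)) * (ψ x - φ x) := by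
    rw [Finset.mul_sum]
    exact Finset.sum_le_sum fun x _ => mul_sub_mul_sub_ge hu hu' (φ x) (ψ x)
  rw [hsplit, sub_mul]
  have h1' : γ * ∑ x, (ψ x - φ x) ^ 2 ≤ ∑ x, (ψ - φ) x * At (ψ - φ) x := by
    simpa only [Pi.sub_apply] using h1
  linarith

/-- **THE ACTION ALONG A SEGMENT**: `t ↦ S(φ + t•h)` has derivative `Σ_x ((At(φ + t•h)) x + u((φ + t•h) x))·h x` at every `t`. [folklore] -/
theorem hasDerivAt_action_line (At : (ι → ℝ) →L[ℝ] (ι → ℝ))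
    (hAt : ∀ φ ψ : ι → ℝ, ∑ x, ψ x * At φ x = ∑ x, φ x * At ψ x) {v u : ℝ → ℝ} (hv : ∀ t, HasDerivAt v (u t) t)
    (φ h : ι → ℝ) (t : ℝ) :
    HasDerivAt (fun t : ℝ => (1 / 2 : ℝ) * ∑ x, (φ + t • h) x * At (φ + t • h) x + ∑ x, v ((φ + t • h) x))
      (∑ x, (At (φ + t • h) x + u ((φ + t • h) x)) * h x) t := by
  obtain ⟨L, hL⟩ := exists_clm_pair (fun x => At (φ + t • h) x + u ((φ + t • h) x))
  have hline : HasDerivAt (fun t : ℝ => φ + t • h) ((1 : ℝ) • h) t := ((hasDerivAt_id t).smul_const h).const_add φ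
  have hc := (hasFDerivAt_action At hAt hv (φ + t • h) hL).comp_hasDerivAt t hline
  rw [one_smul, hL] at hc
  exact hc

/-- **THE FIRST-ORDER LETTER OF THE ACTION** (strong convexity, quantitative, ALL base points): with a form floor `γ` for the symmetric
`At`, `v′ = u`, `u′ ≥ −λ` everywhere: `S φ + DS(φ)(ψ − φ) + ½(γ − λ)·Σ_x (ψ x − φ x)² ≤ S ψ`. [folklore] -/
theorem action_firstOrder_lower (At : (ι → ℝ) →L[ℝ] (ι → ℝ))
    (hAt : ∀ φ ψ : ι → ℝ, ∑ x, ψ x * At φ x = ∑ x, φ x * At ψ x) {γ : ℝ}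
    (hγ : ∀ h : ι → ℝ, γ * ∑ x, h x ^ 2 ≤ ∑ x, h x * At h x) {v u u' : ℝ → ℝ} (hv : ∀ t, HasDerivAt v (u t) t)
    (hu : ∀ t, HasDerivAt u (u' t) t) {lam : ℝ} (hu' : ∀ t, -lam ≤ u' t) (φ ψ : ι → ℝ) :
    ((1 / 2 : ℝ) * ∑ x, φ x * At φ x + ∑ x, v (φ x))
        + fderiv ℝ (fun φ : ι → ℝ => (1 / 2 : ℝ) * ∑ x, φ x * At φ x + ∑ x, v (φ x)) φ (ψ - φ)
        + (γ - lam) / 2 * ∑ x, (ψ x - φ x) ^ 2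
      ≤ (1 / 2 : ℝ) * ∑ x, ψ x * At ψ x + ∑ x, v (ψ x) := by
  set h : ι → ℝ := ψ - φ with hh
  -- the action along the segment and the gap function
  set g : ℝ → ℝ := fun t => (1 / 2 : ℝ) * ∑ x, (φ + t • h) x * At (φ + t • h) x + ∑ x, v ((φ + t • h) x) with hg
  set D0 : ℝ := ∑ x, (At φ x + u (φ x)) * h x with hD0
  set q : ℝ := ∑ x, h x ^ 2 with hq
  set k : ℝ → ℝ := fun t => g t - t * D0 - (γ - lam) / 2 * t ^ 2 * q with hk
  have hg' : ∀ t, HasDerivAt g (∑ x, (At (φ + t • h) x + u ((φ + t • h) x)) * h x) t :=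
    fun t => hasDerivAt_action_line At hAt hv φ h t
  have hk' : ∀ t, HasDerivAt k ((∑ x, (At (φ + t • h) x + u ((φ + t • h) x)) * h x) - D0 - (γ - lam) * t * q) t := by
    intro t
    have h1 : HasDerivAt (fun t : ℝ => t * D0) (1 * D0) t := (hasDerivAt_id t).mul_const D0
    have h2 : HasDerivAt (fun t : ℝ => (γ - lam) / 2 * t ^ 2 * q) ((γ - lam) / 2 * ((2 : ℕ) * t ^ (2 - 1)) * q) t :=
      ((hasDerivAt_pow 2 t).const_mul ((γ - lam) / 2)).mul_const q
    refine (((hg' t).sub h1).sub h2).congr_deriv ?_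
    push_cast
    ring
  -- the gap function has nonnegative derivative on `t ≥ 0`: strong monotonicity of the gradient between `φ` and `φ + t•h`
  have hk'nonneg : ∀ t : ℝ, 0 ≤ t → 0 ≤ (∑ x, (At (φ + t • h) x + u ((φ + t • h) x)) * h x) - D0 - (γ - lam) * t * q := by
    intro t ht
    have hmono := gradient_strongMonotone At hγ hu hu' φ (φ + t • h)
    have e1 : ∀ x, (φ + t • h) x - φ x = t * h x := fun x => by simp
    simp only [e1] at hmono
    have e2 : ∑ x, (t * h x) ^ 2 = t ^ 2 * q := by
      rw [hq, Finset.mul_sum]; exact Finset.sum_congr rfl fun x _ => by ring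
    have e3 : ∑ x, (At (φ + t • h) x + u ((φ + t • h) x) - (At φ x + u (φ x))) * (t * h x)
        = t * ((∑ x, (At (φ + t • h) x + u ((φ + t • h) x)) * h x) - D0) := by
      rw [hD0, ← Finset.sum_sub_distrib, Finset.mul_sum]
      exact Finset.sum_congr rfl fun x _ => by ring
    rw [e2, e3] at hmono
    -- `(γ − λ)·t²·q ≤ t·(g′(t) − D0)`: divide by `t > 0`, or read off `t = 0`
    rcases ht.eq_or_lt with h0 | hpos
    · rw [← h0]; simp [hD0]
    · have : (γ - lam) * t * q ≤ (∑ x, (At (φ + t • h) x + u ((φ + t • h) x)) * h x) - D0 := by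
        have h' : t * ((γ - lam) * t * q) ≤ t * ((∑ x, (At (φ + t • h) x + u ((φ + t • h) x)) * h x) - D0) := by
          calc t * ((γ - lam) * t * q) = (γ - lam) * (t ^ 2 * q) := by ring
            _ ≤ _ := hmono
        exact le_of_mul_le_mul_left h' hpos
      linarith
  have hmonoK : MonotoneOn k (Ici (0 : ℝ)) := by
    refine monotoneOn_of_deriv_nonneg (convex_Ici 0) (fun t _ => (hk' t).continuousAt.continuousWithinAt)
      (fun t _ => (hk' t).differentiableAt.differentiableWithinAt) fun t ht => ?_
    rw [interior_Ici] at ht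
    rw [(hk' t).deriv]
    exact hk'nonneg t (le_of_lt ht)
  have h01 := hmonoK (Set.mem_Ici.2 (le_refl (0 : ℝ))) (Set.mem_Ici.2 (zero_le_one : (0 : ℝ) ≤ 1)) zero_le_one
  -- read `k 0 ≤ k 1`
  have hk0 : k 0 = (1 / 2 : ℝ) * ∑ x, φ x * At φ x + ∑ x, v (φ x) := by simp [hk, hg]
  have hk1 : k 1 = ((1 / 2 : ℝ) * ∑ x, ψ x * At ψ x + ∑ x, v (ψ x)) - D0 - (γ - lam) / 2 * q := by
    simp [hk, hg, hh]
  rw [hk0, hk1] at h01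
  rw [fderiv_action_apply At hAt hv φ (ψ - φ)]
  have hD0' : ∑ x, (At φ x + u (φ x)) * (ψ - φ) x = D0 := by rw [hD0]
  rw [hD0']
  have hq' : ∑ x, (ψ x - φ x) ^ 2 = q := by rw [hq]; exact Finset.sum_congr rfl fun x _ => by simp [hh]
  rw [hq']
  linarith

/-- **AT A FIBRE-CRITICAL FIELD THE LETTER LOSES ITS LINEAR TERM**: if `DS(φ)` kills `ker Qt` and `Qt ψ = Qt φ`, then
`S φ + ½(γ − λ)·Σ(ψ − φ)² ≤ S ψ` — no sign condition. [folklore] -/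
theorem action_fibre_lower_of_critical (At : (ι → ℝ) →L[ℝ] (ι → ℝ))
    (hAt : ∀ φ ψ : ι → ℝ, ∑ x, ψ x * At φ x = ∑ x, φ x * At ψ x) {γ : ℝ}
    (hγ : ∀ h : ι → ℝ, γ * ∑ x, h x ^ 2 ≤ ∑ x, h x * At h x) {v u u' : ℝ → ℝ} (hv : ∀ t, HasDerivAt v (u t) t)
    (hu : ∀ t, HasDerivAt u (u' t) t) {lam : ℝ} (hu' : ∀ t, -lam ≤ u' t) (Qt : (ι → ℝ) →L[ℝ] (κ → ℝ)) {φ : ι → ℝ}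
    (hcrit : ∀ h : ι → ℝ, Qt h = 0 →
      fderiv ℝ (fun φ : ι → ℝ => (1 / 2 : ℝ) * ∑ x, φ x * At φ x + ∑ x, v (φ x)) φ h = 0)
    {ψ : ι → ℝ} (hψ : Qt ψ = Qt φ) :
    ((1 / 2 : ℝ) * ∑ x, φ x * At φ x + ∑ x, v (φ x)) + (γ - lam) / 2 * ∑ x, (ψ x - φ x) ^ 2
      ≤ (1 / 2 : ℝ) * ∑ x, ψ x * At ψ x + ∑ x, v (ψ x) := by
  have h := action_firstOrder_lower At hAt hγ hv hu hu' φ ψ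
  rw [hcrit (ψ - φ) (by rw [map_sub, hψ, sub_self]), add_zero] at h
  exact h

/-- **A FIBRE-CRITICAL FIELD MINIMISES THE ACTION ON ITS FIBRE** (`λ ≤ γ`). [folklore] -/
theorem isMinOn_fibre_of_critical (At : (ι → ℝ) →L[ℝ] (ι → ℝ))
    (hAt : ∀ φ ψ : ι → ℝ, ∑ x, ψ x * At φ x = ∑ x, φ x * At ψ x) {γ : ℝ}
    (hγ : ∀ h : ι → ℝ, γ * ∑ x, h x ^ 2 ≤ ∑ x, h x * At h x) {v u u' : ℝ → ℝ} (hv : ∀ t, HasDerivAt v (u t) t)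
    (hu : ∀ t, HasDerivAt u (u' t) t) {lam : ℝ} (hu' : ∀ t, -lam ≤ u' t) (hγlam : lam ≤ γ) (Qt : (ι → ℝ) →L[ℝ] (κ → ℝ))
    {φ : ι → ℝ} (hcrit : ∀ h : ι → ℝ, Qt h = 0 →
      fderiv ℝ (fun φ : ι → ℝ => (1 / 2 : ℝ) * ∑ x, φ x * At φ x + ∑ x, v (φ x)) φ h = 0) :
    IsMinOn (fun φ : ι → ℝ => (1 / 2 : ℝ) * ∑ x, φ x * At φ x + ∑ x, v (φ x)) {ψ | Qt ψ = Qt φ} φ := by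
  intro ψ hψ
  have h := action_fibre_lower_of_critical At hAt hγ hv hu hu' Qt hcrit hψ
  have hnn : 0 ≤ (γ - lam) / 2 * ∑ x, (ψ x - φ x) ^ 2 :=
    mul_nonneg (div_nonneg (sub_nonneg.2 hγlam) zero_le_two) (Finset.sum_nonneg fun x _ => sq_nonneg _)
  rw [mem_setOf_eq]
  linarith

/-- **TWO FIBRE-CRITICAL FIELDS WITH THE SAME BLOCK MEANS COINCIDE** (`λ < γ`). [folklore] -/
theorem eq_of_critical_of_critical (At : (ι → ℝ) →L[ℝ] (ι → ℝ))
    (hAt : ∀ φ ψ : ι → ℝ, ∑ x, ψ x * At φ x = ∑ x, φ x * At ψ x) {γ : ℝ}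
    (hγ : ∀ h : ι → ℝ, γ * ∑ x, h x ^ 2 ≤ ∑ x, h x * At h x) {v u u' : ℝ → ℝ} (hv : ∀ t, HasDerivAt v (u t) t)
    (hu : ∀ t, HasDerivAt u (u' t) t) {lam : ℝ} (hu' : ∀ t, -lam ≤ u' t) (hγlam : lam < γ) (Qt : (ι → ℝ) →L[ℝ] (κ → ℝ))
    {φ ψ : ι → ℝ} (hQ : Qt ψ = Qt φ)
    (hcritφ : ∀ h : ι → ℝ, Qt h = 0 →
      fderiv ℝ (fun φ : ι → ℝ => (1 / 2 : ℝ) * ∑ x, φ x * At φ x + ∑ x, v (φ x)) φ h = 0)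
    (hcritψ : ∀ h : ι → ℝ, Qt h = 0 →
      fderiv ℝ (fun φ : ι → ℝ => (1 / 2 : ℝ) * ∑ x, φ x * At φ x + ∑ x, v (φ x)) ψ h = 0) :
    φ = ψ := by
  have h1 := action_fibre_lower_of_critical At hAt hγ hv hu hu' Qt hcritφ hQ
  have h2 := action_fibre_lower_of_critical At hAt hγ hv hu hu' Qt hcritψ hQ.symm
  have hsymm : ∑ x, (φ x - ψ x) ^ 2 = ∑ x, (ψ x - φ x) ^ 2 := Finset.sum_congr rfl fun x _ => by ring
  rw [hsymm] at h2
  have hle : (γ - lam) * ∑ x, (ψ x - φ x) ^ 2 ≤ 0 := by linarith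
  have hzero : ∑ x, (ψ x - φ x) ^ 2 = 0 :=
    le_antisymm (nonpos_of_mul_nonpos_right hle (sub_pos.2 hγlam)) (Finset.sum_nonneg fun x _ => sq_nonneg _)
  rw [Finset.sum_eq_zero_iff_of_nonneg fun x _ => sq_nonneg _] at hzero
  funext x
  have hx := hzero x (Finset.mem_univ x)
  rw [sq_eq_zero_iff, sub_eq_zero] at hx
  exact hx.symm

end Generic

/-! ## §3. The torus instance: the background minimises the action on its block-average fibre -/

section Torus

variable (n : ℕ) (a : ℝ) (s : ℕ) [NeZero s]
  {Dop Aop : lp (fun _ : X d => ℝ) ∞ →L[ℝ] lp (fun _ : X d => ℝ) ∞}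
  (hD : ∀ (f : lp (fun _ : X d => ℝ) ∞) (y : X d), Dop f y = (((n : ℝ) + 1) ^ d)⁻¹ * ∑ p ∈ B n y, f p)
  (hA : ∀ (f : lp (fun _ : X d => ℝ) ∞) (p : X d), Aop f p = ∑ r ∈ nbhd n p, AX n a p r * f r)
  {v u u' : ℝ → ℝ} (hv : ∀ t, HasDerivAt v (u t) t) (hu : ∀ t, HasDerivAt u (u' t) t)
  {lam : ℝ} (hlam : ∀ t, |u' t| ≤ lam)
  {Ef : (Site d ((n + 1) * s) → ℝ) →L[ℝ] lp (fun _ : X d => ℝ) ∞}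
  (hEf : ∀ (g : Site d ((n + 1) * s) → ℝ) (q : X d), Ef g q = g (siteOf d ((n + 1) * s) q))
  {Rf : lp (fun _ : X d => ℝ) ∞ →L[ℝ] (Site d ((n + 1) * s) → ℝ)}
  (hRf : ∀ (h : lp (fun _ : X d => ℝ) ∞) (x : Site d ((n + 1) * s)), Rf h x = h (windowMap d ((n + 1) * s) x))
  {Rc : lp (fun _ : X d => ℝ) ∞ →L[ℝ] (Site d s → ℝ)}
  (hRc : ∀ (h : lp (fun _ : X d => ℝ) ∞) (x : Site d s), Rc h x = h (windowMap d s x))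

include hA hv hu hlam hEf hRf in
/-- **THE FIRST-ORDER LETTER OF THE TORUS ACTION**: `At = Rf∘Aop∘Ef` (floor `min(2,a)` by (89)), `|u′| ≤ λ` ⟹ for ALL torus fields
`φ ψ`: `S φ + DS(φ)(ψ − φ) + ½(min(2,a) − λ)·Σ_x (ψ x − φ x)² ≤ S ψ`. [folklore] -/
theorem torus_action_firstOrder_lower (φ ψ : Site d ((n + 1) * s) → ℝ) :
    ((1 / 2 : ℝ) * ∑ x, φ x * ((Rf.comp Aop).comp Ef) φ x + ∑ x, v (φ x))
        + fderiv ℝ (fun φ : Site d ((n + 1) * s) → ℝ =>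
            (1 / 2 : ℝ) * ∑ x, φ x * ((Rf.comp Aop).comp Ef) φ x + ∑ x, v (φ x)) φ (ψ - φ)
        + (min 2 a - lam) / 2 * ∑ x, (ψ x - φ x) ^ 2
      ≤ (1 / 2 : ℝ) * ∑ x, ψ x * ((Rf.comp Aop).comp Ef) ψ x + ∑ x, v (ψ x) :=
  action_firstOrder_lower ((Rf.comp Aop).comp Ef) (torus_operator_form_symm n a s hA hEf hRf)
    (torus_form_coercive n a s hA hEf hRf) hv hu (fun t => (abs_le.1 (hlam t)).1) φ ψ

include hD hA hv hu hlam hEf hRf hRc in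
/-- **THE END: THE BACKGROUND IS THE STRICT MINIMISER OF THE ACTION ON ITS BLOCK-AVERAGE FIBRE, WITH QUADRATIC GAIN.**  If the torus
field `φt` solves the sitewise equation (SBTL's closed-ball letter: `A(Ef φt) + u∘(Ef φt)` equals its own block mean at every site), then
for every torus field `ψ` with the same torus block means, `S φt + ½(min(2,a) − λ)·Σ_x (ψ x − φt x)² ≤ S ψ` — every mesh `n`, period
`s`, dimension `d`; no smallness of `φt` or `ψ` is used. [folklore] -/
theorem torus_background_minimises (φt : Site d ((n + 1) * s) → ℝ)
    (heq : ∀ p : X d, Aop (Ef φt) p + u (Ef φt p)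
      = (((n : ℝ) + 1) ^ d)⁻¹ * ∑ p' ∈ B n (blk n p), (Aop (Ef φt) p' + u (Ef φt p')))
    {ψ : Site d ((n + 1) * s) → ℝ} (hψ : ((Rc.comp Dop).comp Ef) ψ = ((Rc.comp Dop).comp Ef) φt) :
    ((1 / 2 : ℝ) * ∑ x, φt x * ((Rf.comp Aop).comp Ef) φt x + ∑ x, v (φt x))
        + (min 2 a - lam) / 2 * ∑ x, (ψ x - φt x) ^ 2
      ≤ (1 / 2 : ℝ) * ∑ x, ψ x * ((Rf.comp Aop).comp Ef) ψ x + ∑ x, v (ψ x) :=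
  action_fibre_lower_of_critical ((Rf.comp Aop).comp Ef) (torus_operator_form_symm n a s hA hEf hRf)
    (torus_form_coercive n a s hA hEf hRf) hv hu (fun t => (abs_le.1 (hlam t)).1) ((Rc.comp Dop).comp Ef)
    (fun h hh => fderiv_action_torus_eq_zero n a s hD hA hEf hRf hRc hv φt heq h hh) hψ

include hD hA hv hu hlam hEf hRf hRc in
/-- **THE BACKGROUND MINIMISES THE ACTION ON ITS FIBRE** (`λ ≤ min(2,a)`; `IsMinOn` form). [folklore] -/
theorem torus_background_isMinOn (hγ : lam ≤ min 2 a) (φt : Site d ((n + 1) * s) → ℝ)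
    (heq : ∀ p : X d, Aop (Ef φt) p + u (Ef φt p)
      = (((n : ℝ) + 1) ^ d)⁻¹ * ∑ p' ∈ B n (blk n p), (Aop (Ef φt) p' + u (Ef φt p'))) :
    IsMinOn (fun φ : Site d ((n + 1) * s) → ℝ => (1 / 2 : ℝ) * ∑ x, φ x * ((Rf.comp Aop).comp Ef) φ x + ∑ x, v (φ x))
      {ψ | ((Rc.comp Dop).comp Ef) ψ = ((Rc.comp Dop).comp Ef) φt} φt :=
  isMinOn_fibre_of_critical ((Rf.comp Aop).comp Ef) (torus_operator_form_symm n a s hA hEf hRf)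
    (torus_form_coercive n a s hA hEf hRf) hv hu (fun t => (abs_le.1 (hlam t)).1) hγ ((Rc.comp Dop).comp Ef)
    (fun h hh => fderiv_action_torus_eq_zero n a s hD hA hEf hRf hRc hv φt heq h hh)

include hD hA hv hu hlam hEf hRf hRc in
/-- **UNIQUENESS OF THE TORUS BACKGROUND ON THE WHOLE CARRIER** (`λ < min(2,a)`): two torus fields solving the sitewise equation with the
same torus block means coincide — no chart radius, no smallness. [folklore] -/
theorem torus_background_unique (hγ : lam < min 2 a) {φt ψt : Site d ((n + 1) * s) → ℝ}
    (heqφ : ∀ p : X d, Aop (Ef φt) p + u (Ef φt p)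
      = (((n : ℝ) + 1) ^ d)⁻¹ * ∑ p' ∈ B n (blk n p), (Aop (Ef φt) p' + u (Ef φt p')))
    (heqψ : ∀ p : X d, Aop (Ef ψt) p + u (Ef ψt p)
      = (((n : ℝ) + 1) ^ d)⁻¹ * ∑ p' ∈ B n (blk n p), (Aop (Ef ψt) p' + u (Ef ψt p')))
    (hQ : ((Rc.comp Dop).comp Ef) ψt = ((Rc.comp Dop).comp Ef) φt) : φt = ψt :=
  eq_of_critical_of_critical ((Rf.comp Aop).comp Ef) (torus_operator_form_symm n a s hA hEf hRf)
    (torus_form_coercive n a s hA hEf hRf) hv hu (fun t => (abs_le.1 (hlam t)).1) hγ ((Rc.comp Dop).comp Ef) hQ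
    (fun h hh => fderiv_action_torus_eq_zero n a s hD hA hEf hRf hRc hv φt heqφ h hh)
    (fun h hh => fderiv_action_torus_eq_zero n a s hD hA hEf hRf hRc hv ψt heqψ h hh)

end Torus

/-! ## §4. Toy -/

/-- Toy (§1): `u = id`, `u′ ≡ 1 ≥ −0`: `−0·(b − a)² ≤ (b − a)(b − a)`. -/
example (a b : ℝ) : -(0 : ℝ) * (b - a) ^ 2 ≤ (id b - id a) * (b - a) :=
  mul_sub_mul_sub_ge (u := id) (u' := fun _ => (1 : ℝ)) (fun t => hasDerivAt_id t) (lam := 0) (fun _ => by norm_num) a b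

end Summit.QuantumFields.BalabanUV.T4Continuum.NE7b.SupTorusActionConvex

end
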